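import Mathlib
import Literature.Probability.MarkovChains.IntegratedAutocorrelationTime
import Summits.Ventures.LatticeQCDFlow.Scoring.CalibrationTruths
import Summits.Ventures.LatticeQCDFlow.Scoring.FejerPairSums
import Summits.Ventures.LatticeQCDFlow.Scoring.BartlettKernel
import Summits.Ventures.LatticeQCDFlow.Scoring.AcovHatScorerNormalisation
import HarnessLib

/-!
# Mean subtraction biases every empirical autocovariance by `−Var(x̄_N) ≈ −2 τ_int σ²/N`: `N · (E[Γ̂_c(t)] − c(t)) → −Σ_ℤ c`, the same at every lag

HONEST FRAMING: exact (Metropolis-corrected) sampling algorithms for lattice gauge theory;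
figures of merit are autocorrelation/cost numbers at stated couplings and volumes; no
continuum-physics claim.

Venture `LatticeQCDFlow` (cell pub-lqcd), sub-topic `Scoring`; FANOUT row 16 (`su2-base`), GEN-6.
NEW WORK of the cell over this packet (`FejerPairSums.tendsto_sum_sum_int_sub_div`,
`AcovHatScorerNormalisation.tendsto_sum_sum_rect_div`, `BartlettKernel.evenExt/tsum_evenExt`) and
the Literature's `seqMean` (`Literature.Probability.MarkovChains`, Berg 2004 §4.1).  Nothing is
cited as a fact.  Printed counterparts, NAMED ONLY: Berg 2004 eq. (4.14) (bias of `c̄(t)`);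
Broersen 2006 eq. (3.33); Priestley 1981 §5.3.3 (`E[ĉ(t)] ≈ c(t) − Var(x̄)`); Wolff 2004 §3.4
(the `(2τ_int/N)`-type bias correction of the Γ-method).

Thirteenth file of the ERROR-OF-THE-ERROR packet — the first-order effect of the one modelling
step the packet does not carry to the variance: MEAN SUBTRACTION.  The scorers estimate
`Γ̂_c(t) = (1/(N−t)) Σ_{i<N−t} (xᵢ − x̄)(x_{i+t} − x̄)`, `x̄ = (1/N) Σ_{i<N} xᵢ`.  For ANY process with
stationary second moments `E[XᵢXⱼ] = c(j−i)` (no Gaussian hypothesis, no fourth moments):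

* `acovHatC X N t` (the centred estimator); **`integral_acovHatC`** — EXACT, for `t < N`:
  `E[Γ̂_c(t)] = c(t) − (1/(N(N−t))) Σ_{i<N−t} Σ_{j<N} (c(j−i) + c(j−i−t)) + (1/N²) Σ_{i,j<N} c(j−i)`
  (the last term is `E[x̄²] = Var(x̄)` for a centred process, `VarianceOfTheMean`);
* **`tendsto_integral_acovHatC_sub`** — if `c` is summable: `N · (E[Γ̂_c(t)] − c(t)) → −Σ_{m∈ℤ} c(m)`
  as `N → ∞`, at EVERY lag `t` (two rectangle Fejér sums `→ 2Σ_ℤ c`, one square `→ Σ_ℤ c`);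
  **`tendsto_integral_acovHatC_sub'`** — for `c = σ² ρ̄` this limit is `−2 τ_int σ²`: to first order
  mean subtraction lowers every `Γ̂(t)` by `Var(x̄_N) = 2τ_int σ²/N`, hence `ρ̂(t)` by `≈ 2τ_int/N ·
  (1 − ρ(t))`… (the normalised statement is NOT typed; only the autocovariance bias is).

NOT CLAIMED: the effect of mean subtraction on the VARIANCE of `Γ̂`/`τ̂` (second order, `o(1/N)`
relative — not typed); Wolff's specific bias-correction formula; anything at fixed `N` beyond the
exact identity.
-/

noncomputable section

open MeasureTheory ProbabilityTheory Finset Filter Topology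
open Literature.Probability.MarkovChains (seqMean)

namespace Summit.Ventures.LatticeQCDFlow.Scoring

variable {Ω : Type*} {mΩ : MeasurableSpace Ω} {μ : Measure Ω}

/-- The scorers' CENTRED empirical autocovariance:
`Γ̂_c(t) = (1/(N−t)) Σ_{i<N−t} (Xᵢ − x̄_N)(X_{i+t} − x̄_N)`, `x̄_N = seqMean N X`. [ours] -/
def acovHatC (X : ℕ → Ω → ℝ) (N t : ℕ) : Ω → ℝ :=
  fun ω => (∑ i ∈ range (N - t), (X i ω - seqMean N X ω) * (X (i + t) ω - seqMean N X ω))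
    / ((N - t : ℕ) : ℝ)

section Exact

variable {X : ℕ → Ω → ℝ} {c : ℤ → ℝ}

/-- `E[Xₐ · x̄_N] = (1/N) Σ_{j<N} c(j − a)`. -/
theorem integral_mul_seqMean [IsFiniteMeasure μ]
    (hint : ∀ i j, Integrable (fun ω => X i ω * X j ω) μ)
    (htwo : ∀ i j, ∫ ω, X i ω * X j ω ∂μ = c ((j : ℤ) - i)) (a N : ℕ) :
    ∫ ω, X a ω * seqMean N X ω ∂μ = (∑ j ∈ range N, c ((j : ℤ) - a)) / N := by
  simp only [seqMean, mul_div_assoc', mul_sum]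
  rw [integral_div, integral_finsetSum _ fun j _ => hint a j]
  simp_rw [htwo]

/-- `E[x̄_N²] = (1/N²) Σ_{i,j<N} c(j − i)`. -/
theorem integral_seqMean_sq [IsFiniteMeasure μ]
    (hint : ∀ i j, Integrable (fun ω => X i ω * X j ω) μ)
    (htwo : ∀ i j, ∫ ω, X i ω * X j ω ∂μ = c ((j : ℤ) - i)) (N : ℕ) :
    ∫ ω, seqMean N X ω * seqMean N X ω ∂μ
      = (∑ i ∈ range N, ∑ j ∈ range N, c ((j : ℤ) - i)) / ((N : ℝ) * N) := by
  have hI : ∀ i, Integrable (fun ω => X i ω * seqMean N X ω) μ := by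
    intro i
    simp only [seqMean, mul_div_assoc', mul_sum]
    exact (integrable_finsetSum _ fun j _ => hint i j).div_const _
  calc ∫ ω, seqMean N X ω * seqMean N X ω ∂μ
      = ∫ ω, (∑ i ∈ range N, X i ω * seqMean N X ω) / N ∂μ := by
        refine integral_congr_ae (Filter.Eventually.of_forall fun ω => ?_)
        simp only [seqMean, sum_mul, sum_div]
        refine sum_congr rfl fun i _ => by ring
    _ = (∑ i ∈ range N, (∑ j ∈ range N, c ((j : ℤ) - i)) / N) / N := by
        rw [integral_div, integral_finsetSum _ fun i _ => hI i]
        simp_rw [integral_mul_seqMean hint htwo]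
    _ = (∑ i ∈ range N, ∑ j ∈ range N, c ((j : ℤ) - i)) / ((N : ℝ) * N) := by
        rw [← sum_div, div_div]

/-- **The exact mean of the centred autocovariance** (`t < N`, stationary second moments):
`E[Γ̂_c(t)] = c(t) − (1/(N(N−t))) Σ_{i<N−t} Σ_{j<N} (c(j−i) + c(j−i−t)) + (1/N²) Σ_{i,j<N} c(j−i)`. -/
theorem integral_acovHatC [IsFiniteMeasure μ]
    (hint : ∀ i j, Integrable (fun ω => X i ω * X j ω) μ)
    (htwo : ∀ i j, ∫ ω, X i ω * X j ω ∂μ = c ((j : ℤ) - i)) {N t : ℕ} (ht : t < N) :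
    ∫ ω, acovHatC X N t ω ∂μ
      = c t - (∑ i ∈ range (N - t), ∑ j ∈ range N, (c ((j : ℤ) - i) + c ((j : ℤ) - i - t)))
            / ((N : ℝ) * ((N - t : ℕ) : ℝ))
        + (∑ i ∈ range N, ∑ j ∈ range N, c ((j : ℤ) - i)) / ((N : ℝ) * N) := by
  have hNt : ((N - t : ℕ) : ℝ) ≠ 0 := by
    have : 0 < N - t := Nat.sub_pos_of_lt ht
    positivity
  have hN : (N : ℝ) ≠ 0 := by
    have : 0 < N := lt_of_le_of_lt (Nat.zero_le _) ht
    positivity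
  have hIm : ∀ i, Integrable (fun ω => X i ω * seqMean N X ω) μ := by
    intro i
    simp only [seqMean, mul_div_assoc', mul_sum]
    exact (integrable_finsetSum _ fun j _ => hint i j).div_const _
  have hImm : Integrable (fun ω => seqMean N X ω * seqMean N X ω) μ := by
    have : (fun ω => seqMean N X ω * seqMean N X ω)
        = fun ω => (∑ i ∈ range N, X i ω * seqMean N X ω) / N := by
      funext ω
      simp only [seqMean, sum_mul, sum_div]
      exact sum_congr rfl fun i _ => by ring
    rw [this]
    exact (integrable_finsetSum _ fun i _ => hIm i).div_const _
  -- expand the summand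
  have hterm : ∀ i, ∫ ω, (X i ω - seqMean N X ω) * (X (i + t) ω - seqMean N X ω) ∂μ
      = c t - ((∑ j ∈ range N, c ((j : ℤ) - i)) / N + (∑ j ∈ range N, c ((j : ℤ) - i - t)) / N)
        + (∑ i ∈ range N, ∑ j ∈ range N, c ((j : ℤ) - i)) / ((N : ℝ) * N) := by
    intro i
    have e : ∀ ω, (X i ω - seqMean N X ω) * (X (i + t) ω - seqMean N X ω)
        = X i ω * X (i + t) ω - (X i ω * seqMean N X ω + X (i + t) ω * seqMean N X ω)
          + seqMean N X ω * seqMean N X ω := fun ω => by ring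
    have e1 : c (((i + t : ℕ) : ℤ) - (i : ℤ)) = c t := by
      congr 1
      push_cast
      ring
    have e2 : ∀ j : ℕ, c ((j : ℤ) - ((i + t : ℕ) : ℤ)) = c ((j : ℤ) - i - t) := fun j => by
      congr 1
      push_cast
      ring
    simp_rw [e]
    rw [integral_add ?_ hImm, integral_sub (hint i (i + t)) ?_, integral_add (hIm i) (hIm (i + t)),
      htwo, integral_mul_seqMean hint htwo, integral_mul_seqMean hint htwo,
      integral_seqMean_sq hint htwo, e1]
    · simp_rw [e2]
    · exact (hIm i).add (hIm (i + t))
    · exact ((hint i (i + t)).sub ((hIm i).add (hIm (i + t)))).congr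
        (Filter.Eventually.of_forall fun ω => by simp only [Pi.add_apply, Pi.sub_apply])
  have hI : ∀ i ∈ range (N - t),
      Integrable (fun ω => (X i ω - seqMean N X ω) * (X (i + t) ω - seqMean N X ω)) μ := by
    intro i _
    refine (((hint i (i + t)).sub ((hIm i).add (hIm (i + t)))).add hImm).congr
      (Filter.Eventually.of_forall fun ω => ?_)
    simp only [Pi.add_apply, Pi.sub_apply]
    ring
  have hsum : ∑ i ∈ range (N - t),
      ((∑ j ∈ range N, c ((j : ℤ) - i)) / N + (∑ j ∈ range N, c ((j : ℤ) - i - t)) / N)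
      = (∑ i ∈ range (N - t), ∑ j ∈ range N, (c ((j : ℤ) - i) + c ((j : ℤ) - i - t))) / N := by
    rw [sum_div]
    refine sum_congr rfl fun i _ => ?_
    rw [← add_div, ← sum_add_distrib]
  unfold acovHatC
  rw [integral_div, integral_finsetSum _ hI]
  simp_rw [hterm]
  rw [sum_add_distrib, sum_sub_distrib, hsum, sum_const, sum_const, card_range]
  simp only [nsmul_eq_mul]
  field_simp

end Exact

/-! ## The limit: `N · (E[Γ̂_c(t)] − c(t)) → −Σ_ℤ c` -/

/-- The shifted rectangle sum: `(1/N) Σ_{i<N−t} Σ_{j<N} c(j − i − t) → Σ_ℤ c`. -/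
theorem tendsto_sum_sum_shift_div {c : ℤ → ℝ} (hc : Summable c) (t : ℕ) :
    Tendsto (fun N : ℕ => (∑ i ∈ range (N - t), ∑ j ∈ range (N - 0), c ((j : ℤ) - i - t)) / N)
      atTop (𝓝 (∑' m, c m)) := by
  -- `c(j − i − t) = g(j − i)` with `g(m) = c(m − t)`, and `Σ_ℤ g = Σ_ℤ c`
  set g : ℤ → ℝ := fun m => c (m - (t : ℤ)) with hg_def
  have hg : Summable g := (hc.comp_injective (Equiv.subRight (t : ℤ)).injective).congr fun m => by
    simp [hg_def, Equiv.subRight_apply]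
  have hgsum : ∑' m, g m = ∑' m, c m := by
    rw [hg_def]
    exact (Equiv.subRight (t : ℤ)).tsum_eq c
  have h := tendsto_sum_sum_rect_div hg t 0
  rw [hgsum] at h
  exact h

/-- **The mean-subtraction bias.**  For stationary summable second moments,
`N · (E[Γ̂_c(t)] − c(t)) → −Σ_{m∈ℤ} c(m)` as `N → ∞`, at every lag `t`. -/
theorem tendsto_integral_acovHatC_sub [IsFiniteMeasure μ] {X : ℕ → Ω → ℝ} {c : ℤ → ℝ}
    (hint : ∀ i j, Integrable (fun ω => X i ω * X j ω) μ)
    (htwo : ∀ i j, ∫ ω, X i ω * X j ω ∂μ = c ((j : ℤ) - i)) (hc : Summable c) (t : ℕ) :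
    Tendsto (fun N : ℕ => (N : ℝ) * (∫ ω, acovHatC X N t ω ∂μ - c t)) atTop
      (𝓝 (-∑' m, c m)) := by
  -- the three Fejér-type limits
  have hA : Tendsto (fun N : ℕ => (∑ i ∈ range (N - t), ∑ j ∈ range (N - 0), c ((j : ℤ) - i)) / N)
      atTop (𝓝 (∑' m, c m)) := tendsto_sum_sum_rect_div hc t 0
  have hB := tendsto_sum_sum_shift_div hc t
  have hS := tendsto_sum_sum_int_sub_div hc
  -- `N / (N − t) → 1`
  have hR : Tendsto (fun N : ℕ => (N : ℝ) / ((N - t : ℕ) : ℝ)) atTop (𝓝 1) := by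
    have h1 : Tendsto (fun N : ℕ => ((N - t : ℕ) : ℝ) / N) atTop (𝓝 1) := by
      have : Tendsto (fun N : ℕ => 1 - (t : ℝ) / N) atTop (𝓝 (1 - 0)) :=
        tendsto_const_nhds.sub (tendsto_const_div_atTop_nhds_zero_nat _)
      rw [sub_zero] at this
      refine this.congr' ?_
      filter_upwards [eventually_ge_atTop (max t 1)] with N hN
      have hN0 : (N : ℝ) ≠ 0 := by
        have : 1 ≤ N := le_of_max_le_right hN
        positivity
      rw [Nat.cast_sub (le_of_max_le_left hN)]
      field_simp
    have := h1.inv₀ one_ne_zero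
    rw [inv_one] at this
    refine this.congr fun N => ?_
    rw [inv_div]
  -- combine: `N(E − c t) = −(N/(N−t))·(A_N + B_N) + S_N` eventually
  have hlim := ((hR.mul (hA.add hB)).neg).add hS
  have hval : -(1 * (∑' m, c m + ∑' m, c m)) + ∑' m, c m = -∑' m, c m := by ring
  rw [hval] at hlim
  refine hlim.congr' ?_
  filter_upwards [eventually_gt_atTop t] with N hN
  have hNt : ((N - t : ℕ) : ℝ) ≠ 0 := by
    have : 0 < N - t := Nat.sub_pos_of_lt hN
    positivity
  have hN0 : (N : ℝ) ≠ 0 := by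
    have : 0 < N := lt_of_le_of_lt (Nat.zero_le _) hN
    positivity
  rw [integral_acovHatC hint htwo hN]
  simp only [Nat.sub_zero, sum_add_distrib]
  field_simp
  ring

/-- **In autocorrelation units**: for `c = σ² ρ̄` (`ρ 0 = 1`, `Σ|ρ| < ∞`) the bias limit is
`−2 τ_int σ²` — i.e. `E[Γ̂_c(t)] = c(t) − 2τ_int σ²/N + o(1/N)` at every lag: mean subtraction
lowers the whole autocovariance curve by the variance of the sample mean. -/
theorem tendsto_integral_acovHatC_sub' [IsFiniteMeasure μ] {X : ℕ → Ω → ℝ} {ρ : ℕ → ℝ} {σ2 : ℝ}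
    (hint : ∀ i j, Integrable (fun ω => X i ω * X j ω) μ)
    (htwo : ∀ i j, ∫ ω, X i ω * X j ω ∂μ = σ2 * evenExt ρ ((j : ℤ) - i)) (hρ : Summable ρ)
    (h0 : ρ 0 = 1) (t : ℕ) :
    Tendsto (fun N : ℕ => (N : ℝ) * (∫ ω, acovHatC X N t ω ∂μ - σ2 * evenExt ρ t)) atTop
      (𝓝 (-(2 * tauInt ρ * σ2))) := by
  have hc : Summable fun m : ℤ => σ2 * evenExt ρ m := (summable_evenExt hρ).mul_left σ2
  have h := tendsto_integral_acovHatC_sub hint htwo hc t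
  rw [tsum_mul_left, tsum_evenExt hρ h0] at h
  convert h using 2
  ring

end Summit.Ventures.LatticeQCDFlow.Scoring
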